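import Mathlib
import Summits.PneNP.PneNP.Theorems.OverlapGapAlgebraSolvableImpliesStableSectionFilteredRepairFibre

/-!
# PneNP / OverlapGapAlgebra — crux `SolvableImpliesStableSection` (stmt-PneNP-2463):
# the FILTERED REPAIR block (3/6) — instance counts (deferred decisions on the other clauses)

Support for crux `stmt-PneNP-2463` (`Summit.PneNP.PneNP.Theses.OverlapGapAlgebra.SolvableImpliesStableSection`).
Instances `Φ : Fin m → Fin k → Fin n × Bool`; a clause `i` is singled out and the statistics below only
read the OTHER clauses.  `Crit c v`: the content `c` has a negative literal and all its negative literals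
sit on `v`.  For the mean bound of the filtered repair round we count

* `sissF_sum_card_unsafe_le` — over all instances, the number of variables made unsafe by a clause
  other than `i`: `Σ_Φ |U'(Φ)| ≤ n · (#Inst - (2n)^k ((2n)^k - k(n+1)^{k-1})^{m-1})`;
* `sissF_card_allDesSafe_le` — instances in which `t` given distinct variables are all designated (first
  variable of an all-positive clause `≠ i`) and safe (critical for no clause `≠ i`):
  `≤ m^t · (2n)^k · n^{(k-1)t} · ((2n)^k - t k n^{k-1})^{m-1-t}` (choose the designating clauses);
* `sissF_card_nonInj_le` — non-injective `t`-tuples of variables: `≤ t² n^{t-1}`;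
* `sissF_sum_pow_card_le` — the `t`-th moment of the number `s(Φ)` of designated-and-safe variables:
  `Σ_Φ s(Φ)^t ≤ n^t m^t (2n)^k n^{(k-1)t} ((2n)^k - t k n^{k-1})^{m-1-t} + t² n^{t-1} m (2n)^k n^{k-1} ((2n)^k)^{m-2}`… (second term: tuples with a repeated variable, bounded through one designated variable).
No new definitions; axioms `propext`, `Classical.choice`, `Quot.sound`.
-/

set_option linter.dupNamespace false -- `Summit.PneNP.PneNP.…`: summit = sub-problem (D-0017)

namespace Summit.PneNP.PneNP.Theorems

open Finset
open scoped Classical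

section FilteredRepairMoments

variable {k m n : ℕ}

/-- A product over a finset with one distinguished point `i`, a sub-family `I`, and the rest, each
class bounded by a constant. -/
theorem sissF_prod_le_three {ι : Type*} [DecidableEq ι] (s : Finset ι) (i : ι) (hi : i ∈ s)
    (I : Finset ι)
    (hI : I ⊆ s.erase i) (b : ι → ℕ) (P Q R : ℕ) (hP : b i ≤ P) (hQ : ∀ a ∈ I, b a ≤ Q)
    (hR : ∀ a ∈ s.erase i \ I, b a ≤ R) :
    ∏ a ∈ s, b a ≤ P * Q ^ I.card * R ^ (s.card - 1 - I.card) := by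
  rw [← Finset.mul_prod_erase s b hi, ← Finset.prod_sdiff hI]
  have h1 : ∏ a ∈ s.erase i \ I, b a ≤ R ^ (s.erase i \ I).card := Finset.prod_le_pow_card _ _ _ hR
  have h2 : ∏ a ∈ I, b a ≤ Q ^ I.card := Finset.prod_le_pow_card _ _ _ hQ
  have hc : (s.erase i \ I).card = s.card - 1 - I.card := by
    rw [Finset.card_sdiff_of_subset hI, Finset.card_erase_of_mem hi]
  calc b i * ((∏ a ∈ s.erase i \ I, b a) * ∏ a ∈ I, b a)
      ≤ P * (R ^ (s.erase i \ I).card * Q ^ I.card) := Nat.mul_le_mul hP (Nat.mul_le_mul h1 h2)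
    _ = P * Q ^ I.card * R ^ (s.card - 1 - I.card) := by rw [hc]; ring

/-- Instances in which no clause other than `i` is critical for `v`: at least
`(2n)^k ((2n)^k - k(n+1)^{k-1})^{m-1}` of them. -/
theorem sissF_card_safe_ge (i : Fin m) (v : Fin n) :
    (2 * n) ^ k * ((2 * n) ^ k - k * (n + 1) ^ (k - 1)) ^ (m - 1) ≤
      ((univ : Finset (Fin m → Fin k → Fin n × Bool)).filter fun Φ => ∀ a, a ≠ i →
        ¬ ((∃ j, (Φ a j).2 = false) ∧ ∀ j, (Φ a j).2 = false → (Φ a j).1 = v)).card := by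
  have hX : Fintype.card (Fin k → Fin n × Bool) = (2 * n) ^ k := by
    rw [Fintype.card_fun, Fintype.card_prod, Fintype.card_fin, Fintype.card_bool, Fintype.card_fin,
      mul_comm]
  set T : Fin m → Finset (Fin k → Fin n × Bool) := fun a =>
    if a = i then univ else univ.filter fun c =>
      ¬ ((∃ j, (c j).2 = false) ∧ ∀ j, (c j).2 = false → (c j).1 = v) with hT
  have hsub : Fintype.piFinset T ⊆ ((univ : Finset (Fin m → Fin k → Fin n × Bool)).filter fun Φ =>
      ∀ a, a ≠ i → ¬ ((∃ j, (Φ a j).2 = false) ∧ ∀ j, (Φ a j).2 = false → (Φ a j).1 = v)) := by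
    intro Φ hΦ
    rw [Fintype.mem_piFinset] at hΦ
    simp only [mem_filter, mem_univ, true_and]
    intro a ha
    have := hΦ a
    rw [hT] at this
    simp only [if_neg ha, mem_filter, mem_univ, true_and] at this
    exact this
  refine le_trans ?_ (card_le_card hsub)
  rw [Fintype.card_piFinset, ← Finset.mul_prod_erase univ _ (mem_univ i)]
  have hTi : (T i).card = (2 * n) ^ k := by
    simp only [hT, if_true, card_univ, hX]
  rw [hTi]
  refine Nat.mul_le_mul_left _ ?_
  have hrest : ∀ a ∈ (univ : Finset (Fin m)).erase i,
      (2 * n) ^ k - k * (n + 1) ^ (k - 1) ≤ (T a).card := by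
    intro a ha
    have ha' : a ≠ i := (mem_erase.1 ha).1
    simp only [hT, if_neg ha']
    have hsplit := Finset.card_filter_add_card_filter_not
      (s := (univ : Finset (Fin k → Fin n × Bool)))
      (fun c => (∃ j, (c j).2 = false) ∧ ∀ j, (c j).2 = false → (c j).1 = v)
    rw [card_univ, hX] at hsplit
    have hC := sissF_card_crit_le (k := k) (n := n) v
    omega
  calc ((2 * n) ^ k - k * (n + 1) ^ (k - 1)) ^ (m - 1)
      = ((2 * n) ^ k - k * (n + 1) ^ (k - 1)) ^ ((univ : Finset (Fin m)).erase i).card := by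
        rw [card_erase_of_mem (mem_univ _), card_univ, Fintype.card_fin]
    _ ≤ _ := Finset.pow_card_le_prod _ _ _ hrest

/-- **Unsafe variables, summed over instances.** The number of pairs (instance, variable made unsafe
by a clause other than `i`) is at most `n · (#Inst - (2n)^k ((2n)^k - k(n+1)^{k-1})^{m-1})`. -/
theorem sissF_sum_card_unsafe_le (i : Fin m) :
    ∑ Φ : Fin m → Fin k → Fin n × Bool, ((univ : Finset (Fin n)).filter fun v =>
        ∃ a, a ≠ i ∧ (∃ j, (Φ a j).2 = false) ∧ ∀ j, (Φ a j).2 = false → (Φ a j).1 = v).card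
      + n * ((2 * n) ^ k * ((2 * n) ^ k - k * (n + 1) ^ (k - 1)) ^ (m - 1))
      ≤ n * Fintype.card (Fin m → Fin k → Fin n × Bool) := by
  have hswap : ∑ Φ : Fin m → Fin k → Fin n × Bool, ((univ : Finset (Fin n)).filter fun v =>
        ∃ a, a ≠ i ∧ (∃ j, (Φ a j).2 = false) ∧ ∀ j, (Φ a j).2 = false → (Φ a j).1 = v).card
      = ∑ v : Fin n, ((univ : Finset (Fin m → Fin k → Fin n × Bool)).filter fun Φ =>
        ∃ a, a ≠ i ∧ (∃ j, (Φ a j).2 = false) ∧ ∀ j, (Φ a j).2 = false → (Φ a j).1 = v).card := by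
    simp_rw [card_eq_sum_ones, sum_filter]
    exact Finset.sum_comm
  have hv : ∀ v : Fin n, (((univ : Finset (Fin m → Fin k → Fin n × Bool)).filter fun Φ =>
      ∃ a, a ≠ i ∧ (∃ j, (Φ a j).2 = false) ∧ ∀ j, (Φ a j).2 = false → (Φ a j).1 = v).card
      + (2 * n) ^ k * ((2 * n) ^ k - k * (n + 1) ^ (k - 1)) ^ (m - 1)
      ≤ Fintype.card (Fin m → Fin k → Fin n × Bool)) := by
    intro v
    have hsplit := Finset.card_filter_add_card_filter_not
      (s := (univ : Finset (Fin m → Fin k → Fin n × Bool)))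
      (fun Φ => ∃ a, a ≠ i ∧ (∃ j, (Φ a j).2 = false) ∧ ∀ j, (Φ a j).2 = false → (Φ a j).1 = v)
    rw [card_univ] at hsplit
    have hsafe := sissF_card_safe_ge (k := k) (m := m) (n := n) i v
    have heq : ((univ : Finset (Fin m → Fin k → Fin n × Bool)).filter fun Φ =>
        ¬ ∃ a, a ≠ i ∧ (∃ j, (Φ a j).2 = false) ∧ ∀ j, (Φ a j).2 = false → (Φ a j).1 = v)
        = ((univ : Finset (Fin m → Fin k → Fin n × Bool)).filter fun Φ => ∀ a, a ≠ i →
          ¬ ((∃ j, (Φ a j).2 = false) ∧ ∀ j, (Φ a j).2 = false → (Φ a j).1 = v)) := by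
      refine filter_congr fun Φ _ => ?_
      simp only [not_exists, not_and]
    rw [heq] at hsplit
    omega
  rw [hswap]
  calc ∑ v : Fin n, (((univ : Finset (Fin m → Fin k → Fin n × Bool)).filter fun Φ =>
        ∃ a, a ≠ i ∧ (∃ j, (Φ a j).2 = false) ∧ ∀ j, (Φ a j).2 = false → (Φ a j).1 = v).card)
        + n * ((2 * n) ^ k * ((2 * n) ^ k - k * (n + 1) ^ (k - 1)) ^ (m - 1))
      = ∑ v : Fin n, ((((univ : Finset (Fin m → Fin k → Fin n × Bool)).filter fun Φ =>
        ∃ a, a ≠ i ∧ (∃ j, (Φ a j).2 = false) ∧ ∀ j, (Φ a j).2 = false → (Φ a j).1 = v).card)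
        + (2 * n) ^ k * ((2 * n) ^ k - k * (n + 1) ^ (k - 1)) ^ (m - 1)) := by
        rw [sum_add_distrib, sum_const, card_univ, Fintype.card_fin, smul_eq_mul]
    _ ≤ ∑ _v : Fin n, Fintype.card (Fin m → Fin k → Fin n × Bool) := sum_le_sum fun v _ => hv v
    _ = n * Fintype.card (Fin m → Fin k → Fin n × Bool) := by
        rw [sum_const, card_univ, Fintype.card_fin, smul_eq_mul]

/-- **Designated and safe, `t` distinct variables.** The instances in which each of `t` given distinct
variables is the first variable of an all-positive clause other than `i` and is critical for no clause
other than `i` number at most `m^t · (2n)^k · n^{(k-1)t} · ((2n)^k - t k n^{k-1})^{m-1-t}`: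
choose a designating clause for each variable (at most `m^t` choices, distinct clauses by injectivity),
count `n^{k-1}` contents for each of them, anything for clause `i`, and non-critical contents for the
remaining `m-1-t` clauses. -/
theorem sissF_card_allDesSafe_le (hk : 0 < k) (i : Fin m) {t : ℕ} (u : Fin t → Fin n)
    (hu : Function.Injective u) :
    ((univ : Finset (Fin m → Fin k → Fin n × Bool)).filter fun Φ => ∀ l,
        (∃ a, a ≠ i ∧ (Φ a ⟨0, hk⟩).1 = u l ∧ ∀ j, (Φ a j).2 = true) ∧
        ∀ a, a ≠ i → ¬ ((∃ j, (Φ a j).2 = false) ∧ ∀ j, (Φ a j).2 = false → (Φ a j).1 = u l)).card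
      ≤ m ^ t * ((2 * n) ^ k * (n ^ (k - 1)) ^ t * ((2 * n) ^ k - t * (k * n ^ (k - 1))) ^ (m - 1 - t)) := by
  have hX : Fintype.card (Fin k → Fin n × Bool) = (2 * n) ^ k := by
    rw [Fintype.card_fun, Fintype.card_prod, Fintype.card_fin, Fintype.card_bool, Fintype.card_fin,
      mul_comm]
  set D := ((univ : Finset (Fin m → Fin k → Fin n × Bool)).filter fun Φ => ∀ l,
        (∃ a, a ≠ i ∧ (Φ a ⟨0, hk⟩).1 = u l ∧ ∀ j, (Φ a j).2 = true) ∧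
        ∀ a, a ≠ i → ¬ ((∃ j, (Φ a j).2 = false) ∧ ∀ j, (Φ a j).2 = false → (Φ a j).1 = u l))
    with hD
  set W : ℕ := (2 * n) ^ k * (n ^ (k - 1)) ^ t * ((2 * n) ^ k - t * (k * n ^ (k - 1))) ^ (m - 1 - t)
    with hW
  -- the choice of a designating clause
  set φ : (Fin m → Fin k → Fin n × Bool) → (Fin t → Fin m) := fun Φ l =>
    if h : ∃ a, a ≠ i ∧ (Φ a ⟨0, hk⟩).1 = u l ∧ ∀ j, (Φ a j).2 = true then Classical.choose h else i
    with hφ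
  have hφspec : ∀ Φ ∈ D, ∀ l, φ Φ l ≠ i ∧ (Φ (φ Φ l) ⟨0, hk⟩).1 = u l ∧ ∀ j, (Φ (φ Φ l) j).2 = true := by
    intro Φ hΦ l
    have h : ∃ a, a ≠ i ∧ (Φ a ⟨0, hk⟩).1 = u l ∧ ∀ j, (Φ a j).2 = true :=
      ((mem_filter.1 hΦ).2 l).1
    have he : φ Φ l = Classical.choose h := by simp only [hφ, dif_pos h]
    rw [he]
    exact Classical.choose_spec h
  have hsafe : ∀ Φ ∈ D, ∀ l, ∀ a, a ≠ i →
      ¬ ((∃ j, (Φ a j).2 = false) ∧ ∀ j, (Φ a j).2 = false → (Φ a j).1 = u l) :=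
    fun Φ hΦ l => ((mem_filter.1 hΦ).2 l).2
  -- fiberwise
  rw [card_eq_sum_card_fiberwise (f := φ) (t := (univ : Finset (Fin t → Fin m))) fun _ _ => mem_univ _]
  have hfib : ∀ f : Fin t → Fin m, (D.filter fun Φ => φ Φ = f).card ≤ W := by
    intro f
    by_cases hfi : ∃ l, f l = i
    · -- a designating clause is never `i`
      obtain ⟨l, hl⟩ := hfi
      have h0 : (D.filter fun Φ => φ Φ = f) = ∅ := by
        rw [filter_eq_empty_iff]
        intro Φ hΦ he
        have := (hφspec Φ hΦ l).1
        rw [he, hl] at this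
        exact this rfl
      rw [h0, card_empty]
      exact Nat.zero_le _
    push Not at hfi
    -- the box
    set T : Fin m → Finset (Fin k → Fin n × Bool) := fun a =>
      if a = i then univ else if a ∈ univ.image f then
        univ.filter fun c => (∀ l, f l = a → (c ⟨0, hk⟩).1 = u l) ∧ ∀ j, (c j).2 = true
      else univ.filter fun c => ∀ l, ¬ ((∃ j, (c j).2 = false) ∧ ∀ j, (c j).2 = false → (c j).1 = u l)
      with hT
    have hbox : (D.filter fun Φ => φ Φ = f) ⊆ Fintype.piFinset T := by
      intro Φ hΦ
      rw [mem_filter] at hΦ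
      obtain ⟨hΦD, he⟩ := hΦ
      rw [Fintype.mem_piFinset]
      intro a
      simp only [hT]
      split_ifs with hai him
      · exact mem_univ _
      · simp only [mem_filter, mem_univ, true_and]
        obtain ⟨l₀, -, hl₀⟩ := mem_image.1 him
        constructor
        · intro l hl
          have := (hφspec Φ hΦD l).2.1
          rwa [he, hl] at this
        · have := (hφspec Φ hΦD l₀).2.2
          rwa [he, hl₀] at this
      · simp only [mem_filter, mem_univ, true_and]
        exact fun l => hsafe Φ hΦD l a hai
    refine (card_le_card hbox).trans ?_
    rw [Fintype.card_piFinset]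
    by_cases hinj : Function.Injective f
    · -- three classes of clauses
      have hIsub : univ.image f ⊆ (univ : Finset (Fin m)).erase i := by
        intro a ha
        obtain ⟨l, -, rfl⟩ := mem_image.1 ha
        exact mem_erase.2 ⟨hfi l, mem_univ _⟩
      have h3 := sissF_prod_le_three (univ : Finset (Fin m)) i (mem_univ i) (univ.image f) hIsub
        (fun a => (T a).card) ((2 * n) ^ k) (n ^ (k - 1)) ((2 * n) ^ k - t * (k * n ^ (k - 1)))
        (by simp only [hT, if_true, card_univ, hX]; exact le_rfl)
        (by
          intro a ha
          obtain ⟨l₀, -, hl₀⟩ := mem_image.1 ha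
          have hai : a ≠ i := by rw [← hl₀]; exact hfi l₀
          simp only [hT, if_neg hai, if_pos ha]
          refine le_trans (card_le_card ?_) (sissF_card_firstVar_allPos_le hk (u l₀))
          intro c hc
          simp only [mem_filter, mem_univ, true_and] at hc ⊢
          exact ⟨hc.1 l₀ hl₀, hc.2⟩)
        (by
          intro a ha
          rw [mem_sdiff, mem_erase] at ha
          simp only [hT, if_neg ha.1.1, if_neg ha.2]
          have := sissF_card_notCrit_add_le (k := k) u hu
          omega)
      have hIcard : (univ.image f).card = t := by
        rw [card_image_of_injective _ hinj, card_univ, Fintype.card_fin]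
      rw [hIcard, card_univ, Fintype.card_fin] at h3
      simpa only [hW] using h3
    · -- two indices designate the same clause: the box is empty
      have hne : ∃ l l', l ≠ l' ∧ f l = f l' := by
        by_contra h
        push Not at h
        exact hinj fun l l' hll' => by_contra fun hne => h l l' hne hll'
      obtain ⟨l, l', hll', hfl⟩ := hne
      have hempty : T (f l) = ∅ := by
        have hai : f l ≠ i := hfi l
        have him : f l ∈ univ.image f := mem_image.2 ⟨l, mem_univ _, rfl⟩
        simp only [hT, if_neg hai, if_pos him]
        rw [filter_eq_empty_iff]
        intro c _ hc
        have h1 := hc.1 l rfl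
        have h2 := hc.1 l' hfl.symm
        exact hll' (hu (h1.symm.trans h2))
      rw [Finset.prod_eq_zero (mem_univ (f l)) (by rw [hempty, card_empty])]
      exact Nat.zero_le _
  calc ∑ f : Fin t → Fin m, (D.filter fun Φ => φ Φ = f).card ≤ ∑ _f : Fin t → Fin m, W :=
        sum_le_sum fun f _ => hfib f
    _ = m ^ t * W := by
        rw [sum_const, card_univ, Fintype.card_fun, Fintype.card_fin, Fintype.card_fin, smul_eq_mul]

/-- Non-injective `t`-tuples of variables: at most `t² n^{t-1}` (a coincidence `u l = u l'`, `l ≠ l'`,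
and the tuple is determined by its values off `l`). -/
theorem sissF_card_nonInj_le (t n : ℕ) :
    ((univ : Finset (Fin t → Fin n)).filter fun u => ¬ Function.Injective u).card
      ≤ t * t * n ^ (t - 1) := by
  have hsub : ((univ : Finset (Fin t → Fin n)).filter fun u => ¬ Function.Injective u)
      ⊆ ((univ : Finset (Fin t × Fin t)).filter fun p => p.1 ≠ p.2).biUnion fun p =>
          univ.filter fun u : Fin t → Fin n => u p.1 = u p.2 := by
    intro u hu
    simp only [mem_filter, mem_univ, true_and, Function.Injective, not_forall] at hu
    obtain ⟨l, l', he, hne⟩ := hu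
    rw [mem_biUnion]
    exact ⟨(l, l'), by simp [hne], by simp [he]⟩
  have hcard : ∀ p ∈ ((univ : Finset (Fin t × Fin t)).filter fun p => p.1 ≠ p.2),
      ((univ : Finset (Fin t → Fin n)).filter fun u => u p.1 = u p.2).card ≤ n ^ (t - 1) := by
    intro p hp
    have hne : p.1 ≠ p.2 := (mem_filter.1 hp).2
    have hinj : Set.InjOn (fun (u : Fin t → Fin n) (j : {j : Fin t // j ≠ p.1}) => u j.1)
        ↑(((univ : Finset (Fin t → Fin n)).filter fun u => u p.1 = u p.2)) := by
      intro u hu w hw huw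
      simp only [coe_filter, mem_univ, true_and, Set.mem_setOf_eq] at hu hw
      funext j
      by_cases hj : j = p.1
      · subst hj
        rw [hu, hw]
        exact congr_fun huw ⟨p.2, hne.symm⟩
      · exact congr_fun huw ⟨j, hj⟩
    have h := Finset.card_le_card_of_injOn (t := (univ : Finset ({j : Fin t // j ≠ p.1} → Fin n)))
      (fun (u : Fin t → Fin n) (j : {j : Fin t // j ≠ p.1}) => u j.1) (fun _ _ => mem_univ _) hinj
    refine h.trans ?_
    rw [card_univ, Fintype.card_fun, Fintype.card_fin]
    have : Fintype.card {j : Fin t // j ≠ p.1} = t - 1 := by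
      rw [Fintype.card_subtype_compl, Fintype.card_fin, Fintype.card_subtype_eq]
    rw [this]
  calc _ ≤ _ := card_le_card hsub
    _ ≤ ∑ p ∈ ((univ : Finset (Fin t × Fin t)).filter fun p => p.1 ≠ p.2),
          ((univ : Finset (Fin t → Fin n)).filter fun u => u p.1 = u p.2).card := card_biUnion_le
    _ ≤ ∑ _p ∈ ((univ : Finset (Fin t × Fin t)).filter fun p => p.1 ≠ p.2), n ^ (t - 1) :=
        sum_le_sum hcard
    _ = (((univ : Finset (Fin t × Fin t)).filter fun p => p.1 ≠ p.2).card) * n ^ (t - 1) := by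
        rw [sum_const, smul_eq_mul]
    _ ≤ t * t * n ^ (t - 1) := by
        refine Nat.mul_le_mul_right _ ?_
        refine (card_filter_le _ _).trans ?_
        rw [card_univ, Fintype.card_prod, Fintype.card_fin]

/-- **The `t`-th moment of the number of designated-and-safe variables.** With
`S'(Φ) = {v | v is the first variable of an all-positive clause ≠ i and no clause ≠ i is critical for v}`
and `t ≥ 1`: `Σ_Φ |S'(Φ)|^t` is at most the injective-tuple term
`n^t · m^t (2n)^k n^{(k-1)t} ((2n)^k - t k n^{k-1})^{m-1-t}` plus the coincidence term
`t² n^{t-1} · m (2n)^k n^{k-1} ((2n)^k - k n^{k-1})^{m-2}`. -/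
theorem sissF_sum_pow_card_le {k m n : ℕ} (hk : 0 < k) (i : Fin m) (t : ℕ) (ht : 1 ≤ t) :
    ∑ Φ : Fin m → Fin k → Fin n × Bool, ((univ : Finset (Fin n)).filter fun v =>
        (∃ a, a ≠ i ∧ (Φ a ⟨0, hk⟩).1 = v ∧ ∀ j, (Φ a j).2 = true) ∧
        ∀ a, a ≠ i → ¬ ((∃ j, (Φ a j).2 = false) ∧ ∀ j, (Φ a j).2 = false → (Φ a j).1 = v)).card ^ t
      ≤ n ^ t * (m ^ t * ((2 * n) ^ k * (n ^ (k - 1)) ^ t *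
            ((2 * n) ^ k - t * (k * n ^ (k - 1))) ^ (m - 1 - t)))
        + t * t * n ^ (t - 1) * (m ^ 1 * ((2 * n) ^ k * (n ^ (k - 1)) ^ 1 *
            ((2 * n) ^ k - 1 * (k * n ^ (k - 1))) ^ (m - 1 - 1))) := by
  -- abbreviations
  set P : (Fin m → Fin k → Fin n × Bool) → Fin n → Prop := fun Φ v =>
    (∃ a, a ≠ i ∧ (Φ a ⟨0, hk⟩).1 = v ∧ ∀ j, (Φ a j).2 = true) ∧
      ∀ a, a ≠ i → ¬ ((∃ j, (Φ a j).2 = false) ∧ ∀ j, (Φ a j).2 = false → (Φ a j).1 = v) with hP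
  set Winj : ℕ := m ^ t * ((2 * n) ^ k * (n ^ (k - 1)) ^ t *
    ((2 * n) ^ k - t * (k * n ^ (k - 1))) ^ (m - 1 - t)) with hWinj
  set Wone : ℕ := m ^ 1 * ((2 * n) ^ k * (n ^ (k - 1)) ^ 1 *
    ((2 * n) ^ k - 1 * (k * n ^ (k - 1))) ^ (m - 1 - 1)) with hWone
  -- `s^t` counts the `t`-tuples of `S'`
  have hpow : ∀ Φ : Fin m → Fin k → Fin n × Bool,
      ((univ : Finset (Fin n)).filter fun v => P Φ v).card ^ t
        = ∑ u : Fin t → Fin n, if ∀ l, P Φ (u l) then 1 else 0 := by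
    intro Φ
    rw [← Fintype.card_piFinset_const, card_eq_sum_ones, ← sum_filter]
    refine sum_congr ?_ fun _ _ => rfl
    ext u
    simp only [Fintype.mem_piFinset, mem_filter, mem_univ, true_and]
  -- the count for a fixed tuple
  have htuple : ∀ u : Fin t → Fin n,
      (((univ : Finset (Fin m → Fin k → Fin n × Bool)).filter fun Φ => ∀ l, P Φ (u l)).card : ℕ)
        ≤ if Function.Injective u then Winj else Wone := by
    intro u
    split_ifs with hu
    · simpa only [hP, hWinj] using sissF_card_allDesSafe_le hk i u hu
    · -- bound through the single variable `u ⟨0, ht⟩`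
      set u₁ : Fin 1 → Fin n := fun _ => u ⟨0, ht⟩ with hu₁
      have hu₁inj : Function.Injective u₁ := fun a b _ => Subsingleton.elim a b
      have h1 := sissF_card_allDesSafe_le hk i u₁ hu₁inj
      refine le_trans (card_le_card ?_) (by simpa only [hP, hWone] using h1)
      intro Φ hΦ
      simp only [mem_filter, mem_univ, true_and] at hΦ ⊢
      intro l
      exact hΦ ⟨0, ht⟩
  calc ∑ Φ : Fin m → Fin k → Fin n × Bool, ((univ : Finset (Fin n)).filter fun v => P Φ v).card ^ t
      = ∑ Φ : Fin m → Fin k → Fin n × Bool, ∑ u : Fin t → Fin n,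
          (if ∀ l, P Φ (u l) then 1 else 0) := sum_congr rfl fun Φ _ => hpow Φ
    _ = ∑ u : Fin t → Fin n, ∑ Φ : Fin m → Fin k → Fin n × Bool,
          (if ∀ l, P Φ (u l) then 1 else 0) := sum_comm
    _ = ∑ u : Fin t → Fin n,
          ((univ : Finset (Fin m → Fin k → Fin n × Bool)).filter fun Φ => ∀ l, P Φ (u l)).card := by
        refine sum_congr rfl fun u _ => ?_
        rw [card_eq_sum_ones, sum_filter]
    _ ≤ ∑ u : Fin t → Fin n, (if Function.Injective u then Winj else Wone) :=
        sum_le_sum fun u _ => htuple u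
    _ = (∑ u ∈ (univ : Finset (Fin t → Fin n)).filter (fun u => Function.Injective u), Winj)
        + ∑ u ∈ (univ : Finset (Fin t → Fin n)).filter (fun u => ¬ Function.Injective u), Wone :=
        sum_ite _ _
    _ ≤ n ^ t * Winj + t * t * n ^ (t - 1) * Wone := by
        rw [sum_const, sum_const, smul_eq_mul, smul_eq_mul]
        refine Nat.add_le_add (Nat.mul_le_mul_right _ ?_)
          (Nat.mul_le_mul_right _ (sissF_card_nonInj_le t n))
        refine (card_filter_le _ _).trans ?_
        rw [card_univ, Fintype.card_fun, Fintype.card_fin, Fintype.card_fin]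

end FilteredRepairMoments

end Summit.PneNP.PneNP.Theorems
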